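import Literature.IUT.LogVolume.LogVolume
import Literature.NumberTheory.GaloisRepresentations.UniformizerResidueIndex
import HarnessLib

/-!
# [AbsTopIII] Proposition 5.7 (i): the volume and the log-volume on a nonarchimedean local field

Mochizuki, *Topics in Absolute Anabelian Geometry III*, Prop. 5.7 (Local Volumes) (i), kurims manuscript
pp. 137–139, read on the page: "Suppose that `k` is nonarchimedean. Write `m_k ⊆ O_k` for the maximal
ideal of `O_k` and `M(k)` for the set of compact open subsets of `k`. Then: (a) There exists a unique map
`μ_k : M(k) → ℝ_{>0}` that satisfies the following properties: (1) additivity, i.e., `μ_k(A ∪ B) =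
μ_k(A) + μ_k(B)`, for `A, B ∈ M(k)` such that `A ∩ B = ∅`; (2) ⊞-translation invariance, i.e.,
`μ_k(A + x) = μ_k(A)`, for `A ∈ M(k)`, `x ∈ k`; (3) normalization, i.e., `μ_k(O_k) = 1`. We shall refer to
`μ_k(−)` as the volume on `k`. Also, we shall write `μ^log_k(−) := log(μ_k(−))` … and refer to `μ^log_k(−)`
as the log-volume on `k`. If the residue field of `k` is of cardinality `p^f`, …, then, for `n ∈ ℤ`,
`μ^log_k(m_k^n) = −f·n·log(p)`. (b) Let `x ∈ k^×`; set `μ̇_k(x) := μ_k(x·O_k)`, `μ̇^log_k(x) := log(μ̇_k(x))`.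
Then for `A ∈ M(k)`, we have `μ^log_k(x·A) = μ^log_k(A) + μ̇^log_k(x)`; in particular, if `x ∈ O_k^×`, then
`μ^log_k(x·A) = μ^log_k(A)`."

This file constructs these objects for a nonarchimedean local field in the tree's NORM presentation
(`NontriviallyNormedField K`, `IsUltrametricDist K`, `ProperSpace K`; applies verbatim to `ℚ_[p]` and to
completions `K_v`) as the instance `Λ = O_k = closedBall 0 1` of `NormalizedHaar.lean`/`LogVolume.lean`,
reusing the tree's `Literature.NumberTheory.GaloisRepresentations.{UniformizerModulus,
UniformizerResidueIndex, NormUniformizer}` (`unitBall`, norm uniformizers, `distribHaarChar K ϖ = q⁻¹`):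

* `localVolume K` = `μ_k` (existence, `μ_k(O_k) = 1`, Haar, and uniqueness among Haar measures:
  `eq_localVolume`); `localLogVolume K` = `μ^log_k`; the residue cardinality `residueCard K` = `q`;
* `localVolume_closedBall_zpow` / `localLogVolume_closedBall_zpow`: `μ_k(m_k^n) = q^{−n}`,
  `μ^log_k(m_k^n) = −n·log q` (`n ∈ ℤ`, `m_k^n = closedBall 0 ‖ϖ‖^n`), and `= −f·n·log p` when `q = p^f`
  (`localLogVolume_closedBall_zpow_of_residueCard_eq_pow`);
* (b): `mulVolume K x = μ̇_k(x) = distribHaarChar K x`, `mulLogVolume`, `localLogVolume_units_smul`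
  (`μ^log_k(x·A) = μ^log_k(A) + μ̇^log_k(x)`), `localLogVolume_units_smul_of_norm_eq_one`;
* the NORMALISED log-volume of [IUTchIV] Prop. 1.4 (i) on one field, `normalizedLocalLogVolume K d`,
  with "`μ^log(R_i) = 0`" and "`μ^log(p·R_i) = −log(p)`" under the classical relations `‖p‖ = ‖ϖ‖^e`,
  `q = p^f`, `d = e·f` (supplied by the MLF files of this campaign; hypotheses here).

The uniqueness clause of (a) in its printed FINITELY-ADDITIVE form and the log-compatibility (c) are in
`LocalFieldVolumeUnique.lean`. [cite: MochizukiAbsTopIII2015, Prop. 5.7 (i) pp. 137–139]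
[cite: Mochizuki2012, IUTchIV Prop. 1.4 (i) p. 13] Deliberately NOT here: the `p`-adic logarithm, any
IUT-specific object, any judgement on [IUTchIII] Cor. 3.12.
-/

noncomputable section

open MeasureTheory MeasureTheory.Measure Set Metric TopologicalSpace
open scoped ENNReal NNReal Pointwise NormedField
open Literature.NumberTheory.GaloisRepresentations.Ultrametric

namespace Literature.IUT.LogVolume

variable (K : Type*) [NontriviallyNormedField K] [IsUltrametricDist K] [ProperSpace K]

/-- `O_k = {‖x‖ ≤ 1}` as an integral structure (compact open additive subgroup) on the local field `k`.
[cite: MochizukiAbsTopIII2015, Prop. 5.7 (i) p. 137] -/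
def unitBallStructure : IntegralStructure K := ⟨unitBall K, isCompact_closedBall (0 : K) 1⟩

/-- `O_k` as a set is the closed unit ball. [cite: MochizukiAbsTopIII2015, Prop. 5.7 (i) p. 137] -/
@[simp] theorem coe_unitBallStructure : (unitBallStructure K : Set K) = closedBall (0 : K) 1 := rfl

/-- The residue cardinality `q = #(O_k/m_k)` ("the residue field of `k` is of cardinality `p^f`").
[cite: MochizukiAbsTopIII2015, Prop. 5.7 (i)(a) p. 137] -/
def residueCard : ℕ := Nat.card (IsLocalRing.ResidueField (Valued.integer K))

/-- `q ≥ 2`. [cite: MochizukiAbsTopIII2015, Prop. 5.7 (i)(a) p. 137] -/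
theorem two_le_residueCard : 2 ≤ residueCard K := by
  obtain ⟨ϖ, hϖ⟩ := exists_isUniformizer (F := K)
  exact hϖ.two_le_card_residueField

/-- `q > 1` as a real number. [cite: MochizukiAbsTopIII2015, Prop. 5.7 (i)(a) p. 137] -/
theorem one_lt_residueCard_real : (1 : ℝ) < residueCard K := by
  have := two_le_residueCard K
  exact_mod_cast this

/-- For a norm uniformizer `ϖ`: `distribHaarChar K ϖ = q⁻¹` (Weil's `mod_k(π) = q⁻¹`).
[cite: MochizukiAbsTopIII2015, Prop. 5.7 (i)(a) p. 137] -/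
theorem distribHaarChar_uniformizer_eq {ϖ : Kˣ} (hϖ : IsUniformizer ϖ) :
    distribHaarChar K ϖ = ((residueCard K : ℝ≥0))⁻¹ :=
  hϖ.distribHaarChar_eq_inv_card_residueField

variable [MeasurableSpace K] [BorelSpace K]

/-- **The volume on `k`**: the additive Haar measure `μ_k` with `μ_k(O_k) = 1`.
[cite: MochizukiAbsTopIII2015, Prop. 5.7 (i)(a) p. 137] -/
def localVolume : Measure K := (unitBallStructure K).haar

/-- Normalisation (3): `μ_k(O_k) = 1`. [cite: MochizukiAbsTopIII2015, Prop. 5.7 (i)(a)(3) p. 137] -/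
@[simp] theorem localVolume_closedBall_one : localVolume K (closedBall (0 : K) 1) = 1 :=
  (unitBallStructure K).haar_self

/-- `μ_k` is an additive Haar measure: (1) additivity and (2) translation invariance.
[cite: MochizukiAbsTopIII2015, Prop. 5.7 (i)(a)(1)(2) p. 137] -/
instance isAddHaarMeasure_localVolume : IsAddHaarMeasure (localVolume K) := by
  unfold localVolume; infer_instance

/-- Translation invariance (2): `μ_k(A + x) = μ_k(A)`. [cite: MochizukiAbsTopIII2015, Prop. 5.7 (i)(a)(2) p. 137] -/
theorem localVolume_vadd (x : K) (A : Set K) : localVolume K (x +ᵥ A) = localVolume K A :=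
  measure_vadd _ _ _

/-- Additivity (1): `μ_k(A ∪ B) = μ_k(A) + μ_k(B)` for disjoint `A`, `B` (`B` measurable).
[cite: MochizukiAbsTopIII2015, Prop. 5.7 (i)(a)(1) p. 137] -/
theorem localVolume_union {A B : Set K} (hB : MeasurableSet B) (h : Disjoint A B) :
    localVolume K (A ∪ B) = localVolume K A + localVolume K B :=
  measure_union h hB

/-- `μ_k : M(k) → ℝ_{>0}`: nonempty compact open sets have positive finite volume.
[cite: MochizukiAbsTopIII2015, Prop. 5.7 (i)(a) p. 137] -/
theorem localVolume_real_pos (A : CompactOpens K) (hne : (A : Set K).Nonempty) :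
    0 < (localVolume K (A : Set K)).toReal :=
  (unitBallStructure K).haar_real_compactOpens_pos A hne

/-- **Uniqueness** of the volume on `k`: EVERY additive Haar measure `μ` on `k` with `μ(O_k) = 1` is
`μ_k` (on a proper ultrametric field all Haar measures are regular).
[cite: MochizukiAbsTopIII2015, Prop. 5.7 (i)(a) p. 137] -/
theorem eq_localVolume (μ : Measure K) [IsAddHaarMeasure μ] (hμ : μ (closedBall (0 : K) 1) = 1) :
    μ = localVolume K := by
  haveI := regular_of_isAddHaarMeasure μ
  exact (unitBallStructure K).eq_haar μ hμ

/-- Every additive Haar measure on `k` is the multiple `μ(O_k) · μ_k`.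
[cite: MochizukiAbsTopIII2015, Prop. 5.7 (i)(a) p. 137] -/
theorem isAddHaarMeasure_eq_smul_localVolume (μ : Measure K) [IsAddHaarMeasure μ] :
    μ = μ (closedBall (0 : K) 1) • localVolume K := by
  haveI := regular_of_isAddHaarMeasure μ
  exact (unitBallStructure K).haar_unique μ

/-- **The log-volume on `k`**: `μ^log_k(A) := log μ_k(A)`.
[cite: MochizukiAbsTopIII2015, Prop. 5.7 (i)(a) p. 137] -/
def localLogVolume (A : Set K) : ℝ := (unitBallStructure K).logVolume A

/-- Unfolding: `μ^log_k(A) = log μ_k(A)`. [cite: MochizukiAbsTopIII2015, Prop. 5.7 (i)(a) p. 137] -/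
theorem localLogVolume_eq_log (A : Set K) :
    localLogVolume K A = Real.log (localVolume K A).toReal := rfl

/-- `μ^log_k(O_k) = 0`. [cite: MochizukiAbsTopIII2015, Prop. 5.7 (i)(a) p. 137] -/
@[simp] theorem localLogVolume_closedBall_one : localLogVolume K (closedBall (0 : K) 1) = 0 :=
  (unitBallStructure K).logVolume_self

/-- Translation invariance of `μ^log_k`. [cite: MochizukiAbsTopIII2015, Prop. 5.7 (i)(a)(2) p. 137] -/
@[simp] theorem localLogVolume_vadd (x : K) (A : Set K) :
    localLogVolume K (x +ᵥ A) = localLogVolume K A :=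
  (unitBallStructure K).logVolume_vadd x A

/-! ### Volumes of the ideals `m_k^n` -/

/-- Scaling by a unit of `k`: `μ_k(x·A) = mod_k(x) · μ_k(A)` with `mod_k = distribHaarChar K`.
[cite: MochizukiAbsTopIII2015, Prop. 5.7 (i)(b) p. 138] -/
theorem localVolume_units_smul (x : Kˣ) (A : Set K) :
    localVolume K (x • A) = distribHaarChar K x * localVolume K A :=
  measure_units_smul (localVolume K) x A

omit [IsUltrametricDist K] [ProperSpace K] [MeasurableSpace K] [BorelSpace K] in
/-- `m_k^n = ϖ^n · O_k` (`n ∈ ℤ`): `ϖ^n • closedBall 0 1 = closedBall 0 ‖ϖ‖^n`.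
[cite: MochizukiAbsTopIII2015, Prop. 5.7 (i)(a) p. 137] -/
theorem units_zpow_smul_closedBall_one (ϖ : Kˣ) (n : ℤ) :
    (ϖ ^ n) • closedBall (0 : K) 1 = closedBall (0 : K) (‖(ϖ : K)‖ ^ n) := by
  rw [units_smul_unitBall]
  congr 1
  rw [Units.val_zpow_eq_zpow_val, norm_zpow]

/-- **`μ_k(m_k^n) = q^{−n}`** for `n ∈ ℤ` and a uniformizer `ϖ` (`m_k^n = closedBall 0 ‖ϖ‖^n`).
[cite: MochizukiAbsTopIII2015, Prop. 5.7 (i)(a) p. 137] -/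
theorem localVolume_closedBall_zpow {ϖ : Kˣ} (hϖ : IsUniformizer ϖ) (n : ℤ) :
    localVolume K (closedBall (0 : K) (‖(ϖ : K)‖ ^ n)) =
      ((((residueCard K : ℝ≥0))⁻¹ ^ n : ℝ≥0) : ℝ≥0∞) := by
  rw [← units_zpow_smul_closedBall_one, localVolume_units_smul, localVolume_closedBall_one, mul_one,
    map_zpow, distribHaarChar_uniformizer_eq K hϖ]

/-- The same in `ℝ`: `μ_k(m_k^n) = q^{−n}`. [cite: MochizukiAbsTopIII2015, Prop. 5.7 (i)(a) p. 137] -/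
theorem localVolume_real_closedBall_zpow {ϖ : Kˣ} (hϖ : IsUniformizer ϖ) (n : ℤ) :
    (localVolume K (closedBall (0 : K) (‖(ϖ : K)‖ ^ n))).toReal = (residueCard K : ℝ) ^ (-n) := by
  rw [localVolume_closedBall_zpow K hϖ n, ENNReal.coe_toReal, NNReal.coe_zpow, NNReal.coe_inv,
    NNReal.coe_natCast, inv_zpow', ]

/-- **`μ^log_k(m_k^n) = −n·log q`** (`n ∈ ℤ`). [cite: MochizukiAbsTopIII2015, Prop. 5.7 (i)(a) p. 137] -/
theorem localLogVolume_closedBall_zpow {ϖ : Kˣ} (hϖ : IsUniformizer ϖ) (n : ℤ) :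
    localLogVolume K (closedBall (0 : K) (‖(ϖ : K)‖ ^ n)) = -(n * Real.log (residueCard K)) := by
  rw [localLogVolume_eq_log, localVolume_real_closedBall_zpow K hϖ n, Real.log_zpow]
  push_cast
  ring

/-- **As printed**: "If the residue field of `k` is of cardinality `p^f` …, then, for `n ∈ ℤ`,
`μ^log_k(m_k^n) = −f·n·log(p)`." [cite: MochizukiAbsTopIII2015, Prop. 5.7 (i)(a) p. 137] -/
theorem localLogVolume_closedBall_zpow_of_residueCard_eq_pow {ϖ : Kˣ} (hϖ : IsUniformizer ϖ)
    {p f : ℕ} (hq : residueCard K = p ^ f) (n : ℤ) :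
    localLogVolume K (closedBall (0 : K) (‖(ϖ : K)‖ ^ n)) = -(f * n * Real.log p) := by
  rw [localLogVolume_closedBall_zpow K hϖ n, hq]
  push_cast
  rw [Real.log_pow]
  ring

/-! ### (b) Multiplicative translates: `μ̇_k(x)` and `μ^log_k(x·A) = μ^log_k(A) + μ̇^log_k(x)` -/

/-- `μ̇_k(x) := μ_k(x·O_k)` for `x ∈ k^×`. [cite: MochizukiAbsTopIII2015, Prop. 5.7 (i)(b) p. 138] -/
def mulVolume (x : Kˣ) : ℝ≥0∞ := localVolume K (x • closedBall (0 : K) 1)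

/-- `μ̇_k(x)` is the modulus `mod_k(x) = distribHaarChar K x`.
[cite: MochizukiAbsTopIII2015, Prop. 5.7 (i)(b) p. 138] -/
theorem mulVolume_eq_distribHaarChar (x : Kˣ) : mulVolume K x = distribHaarChar K x := by
  rw [mulVolume, localVolume_units_smul, localVolume_closedBall_one, mul_one]

/-- `μ̇^log_k(x) := log(μ̇_k(x))`. [cite: MochizukiAbsTopIII2015, Prop. 5.7 (i)(b) p. 138] -/
def mulLogVolume (x : Kˣ) : ℝ := Real.log (mulVolume K x).toReal

/-- `μ̇^log_k(x) = log mod_k(x)`. [cite: MochizukiAbsTopIII2015, Prop. 5.7 (i)(b) p. 138] -/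
theorem mulLogVolume_eq_log_distribHaarChar (x : Kˣ) :
    mulLogVolume K x = Real.log (distribHaarChar K x : ℝ≥0) := by
  rw [mulLogVolume, mulVolume_eq_distribHaarChar, ENNReal.coe_toReal]

/-- `μ̇^log_k(ϖ^n) = −n·log q` for a uniformizer `ϖ`, `n ∈ ℤ`.
[cite: MochizukiAbsTopIII2015, Prop. 5.7 (i)(a)(b) pp. 137–138] -/
theorem mulLogVolume_uniformizer_zpow {ϖ : Kˣ} (hϖ : IsUniformizer ϖ) (n : ℤ) :
    mulLogVolume K (ϖ ^ n) = -(n * Real.log (residueCard K)) := by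
  rw [mulLogVolume, mulVolume, units_zpow_smul_closedBall_one, ← localLogVolume_eq_log]
  exact localLogVolume_closedBall_zpow K hϖ n

/-- **(b)**: `μ^log_k(x·A) = μ^log_k(A) + μ̇^log_k(x)` for `x ∈ k^×` and `A` of positive finite volume
(e.g. `A ∈ M(k)` nonempty). [cite: MochizukiAbsTopIII2015, Prop. 5.7 (i)(b) p. 138] -/
theorem localLogVolume_units_smul (x : Kˣ) {A : Set K} (hA : 0 < localVolume K A)
    (hA' : localVolume K A < ∞) :
    localLogVolume K (x • A) = localLogVolume K A + mulLogVolume K x := by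
  rw [localLogVolume_eq_log, localVolume_units_smul, ENNReal.toReal_mul,
    Real.log_mul _ (ENNReal.toReal_pos hA.ne' hA'.ne).ne', mulLogVolume_eq_log_distribHaarChar,
    localLogVolume_eq_log, ENNReal.coe_toReal, add_comm]
  rw [ENNReal.coe_toReal]
  exact_mod_cast (distribHaarChar_pos).ne'

/-- (b) on `M(k)`: `μ^log_k(x·A) = μ^log_k(A) + μ̇^log_k(x)` for a nonempty compact open `A`.
[cite: MochizukiAbsTopIII2015, Prop. 5.7 (i)(b) p. 138] -/
theorem localLogVolume_units_smul_compactOpens (x : Kˣ) (A : CompactOpens K)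
    (hne : (A : Set K).Nonempty) :
    localLogVolume K (x • (A : Set K)) = localLogVolume K A + mulLogVolume K x :=
  localLogVolume_units_smul K x ((unitBallStructure K).haar_compactOpens_pos A hne)
    ((unitBallStructure K).haar_compactOpens_lt_top A)

/-- "in particular, if `x ∈ O_k^×`, then `μ^log_k(x·A) = μ^log_k(A)`" — in fact `μ_k(x·A) = μ_k(A)`.
[cite: MochizukiAbsTopIII2015, Prop. 5.7 (i)(b) p. 138] -/
theorem localVolume_units_smul_of_norm_eq_one (x : Kˣ) (hx : ‖(x : K)‖ = 1) (A : Set K) :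
    localVolume K (x • A) = localVolume K A := by
  rw [localVolume_units_smul, distribHaarChar_eq_one_of_norm_eq_one x hx, ENNReal.coe_one, one_mul]

/-- Log form: `x ∈ O_k^×` ⟹ `μ^log_k(x·A) = μ^log_k(A)` (no hypothesis on `A`).
[cite: MochizukiAbsTopIII2015, Prop. 5.7 (i)(b) p. 138] -/
theorem localLogVolume_units_smul_of_norm_eq_one (x : Kˣ) (hx : ‖(x : K)‖ = 1) (A : Set K) :
    localLogVolume K (x • A) = localLogVolume K A := by
  rw [localLogVolume_eq_log, localLogVolume_eq_log, localVolume_units_smul_of_norm_eq_one K x hx]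

/-- `μ̇^log_k(x) = 0` for `x ∈ O_k^×`. [cite: MochizukiAbsTopIII2015, Prop. 5.7 (i)(b) p. 138] -/
theorem mulLogVolume_of_norm_eq_one (x : Kˣ) (hx : ‖(x : K)‖ = 1) : mulLogVolume K x = 0 := by
  rw [mulLogVolume, mulVolume, localVolume_units_smul_of_norm_eq_one K x hx,
    localVolume_closedBall_one]
  simp

/-! ### The normalised log-volume of [IUTchIV] Prop. 1.4 (i) on one field -/

/-- [IUTchIV] Prop. 1.4 (i) on a single field `k_i`: `μ^log(A) := μ^log_{k_i}(A) / d`, the log-volume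
"normalized [i.e., by dividing by the degree of the finite extension]"; the degree `d = [k_i : ℚ_p]` is a
parameter here. [cite: Mochizuki2012, IUTchIV Prop. 1.4 (i) p. 13] -/
def normalizedLocalLogVolume (d : ℕ) (A : Set K) : ℝ := (unitBallStructure K).normalizedLogVolume d A

/-- Unfolding: `μ^log(A) = μ^log_k(A) / d`. [cite: Mochizuki2012, IUTchIV Prop. 1.4 (i) p. 13] -/
theorem normalizedLocalLogVolume_eq_div (d : ℕ) (A : Set K) :
    normalizedLocalLogVolume K d A = localLogVolume K A / d := rfl

/-- "normalized so that `μ^log(R_i) = 0`". [cite: Mochizuki2012, IUTchIV Prop. 1.4 (i) p. 13] -/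
@[simp] theorem normalizedLocalLogVolume_closedBall_one (d : ℕ) :
    normalizedLocalLogVolume K d (closedBall (0 : K) 1) = 0 :=
  (unitBallStructure K).normalizedLogVolume_self d

/-- `μ^log(m_k^n) = −(n/e)·log p` in the normalisation by `d = e·f` when `q = p^f`: the normalised
log-volume of `closedBall 0 ‖ϖ‖^n` is `−(f·n/d)·log p`. [cite: Mochizuki2012, IUTchIV Prop. 1.4 (i) p. 13] -/
theorem normalizedLocalLogVolume_closedBall_zpow {ϖ : Kˣ} (hϖ : IsUniformizer ϖ) {p f : ℕ}
    (hq : residueCard K = p ^ f) (d : ℕ) (n : ℤ) :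
    normalizedLocalLogVolume K d (closedBall (0 : K) (‖(ϖ : K)‖ ^ n)) =
      -(f * n * Real.log p) / d := by
  rw [normalizedLocalLogVolume_eq_div, localLogVolume_closedBall_zpow_of_residueCard_eq_pow K hϖ hq]

/-- **"normalized so that `μ^log(p·R_i) = −log(p)`"**: if `‖p‖ = ‖ϖ‖^e` (ramification index `e`),
`q = p^f` (residue degree `f`) and `d = e·f ≠ 0` (the degree), then the weight-`d` log-volume of
`p·O_k = closedBall 0 ‖p‖` is `−log p`. [cite: Mochizuki2012, IUTchIV Prop. 1.4 (i) p. 13] -/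
theorem normalizedLocalLogVolume_closedBall_norm_p {ϖ : Kˣ} (hϖ : IsUniformizer ϖ) {p e f d : ℕ}
    (hp : ‖(p : K)‖ = ‖(ϖ : K)‖ ^ e) (hq : residueCard K = p ^ f) (hd : d = e * f) (hd0 : d ≠ 0) :
    normalizedLocalLogVolume K d (closedBall (0 : K) ‖(p : K)‖) = -Real.log p := by
  rw [hp, ← zpow_natCast, normalizedLocalLogVolume_closedBall_zpow K hϖ hq d (e : ℤ), hd]
  have : ((e * f : ℕ) : ℝ) ≠ 0 := by rw [← hd]; exact_mod_cast hd0
  push_cast at this ⊢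
  obtain ⟨he, hf⟩ := mul_ne_zero_iff.mp this
  field_simp

/-- The same for the set `p • O_k` when `p ≠ 0` in `k` (mixed characteristic).
[cite: Mochizuki2012, IUTchIV Prop. 1.4 (i) p. 13] -/
theorem normalizedLocalLogVolume_p_smul_closedBall_one {ϖ : Kˣ} (hϖ : IsUniformizer ϖ)
    {p e f d : ℕ} (hp0 : (p : K) ≠ 0) (hp : ‖(p : K)‖ = ‖(ϖ : K)‖ ^ e) (hq : residueCard K = p ^ f)
    (hd : d = e * f) (hd0 : d ≠ 0) :
    normalizedLocalLogVolume K d ((p : K) • closedBall (0 : K) 1) = -Real.log p := by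
  have : (p : K) • closedBall (0 : K) 1 = closedBall (0 : K) ‖(p : K)‖ := by
    rw [smul_closedBall' hp0, smul_zero, mul_one]
  rw [this]
  exact normalizedLocalLogVolume_closedBall_norm_p K hϖ hp hq hd hd0

end Literature.IUT.LogVolume
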